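import Summits.QuantumFields.BalabanUV.T4Continuum.Support.NE3CovariantBlockDivergence
import Summits.QuantumFields.BalabanUV.T4Continuum.Support.NE3CovariantLineSplit
import Summits.QuantumFields.BalabanUV.T4Continuum.Support.NE3FrameFreeDecompositionPrep
import HarnessLib

/-!
# T⁴ programme, node NE3 — route H♮ (ruling ρ-g22-2), row K4, file K4-c (2∕2): THE LANDAU KILL AT A CURVED BACKGROUND —
# `Σ_x Σ_κ hsR (JmpW M W (D_U ψ) x κ) (η x κ) = −M²·Σ_y hsR (covDiv W η y) (psiExt y) + M²·Σ_z hsR (ψ z) (loop functionals)`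

NE3 (node U1b), row NE3 OWNER `b2b-balaban-t4-ne3-p1` (gen 23), K4 holder; SHAPE K4 (journal l.17848) item **K4-c**, ρ-g22-2a A1,
RULING ρ-g23-1 (root transport = the block tree); INTENT ∕ CLAIM journal l.18427.  On file 1 `NE3CovariantBlockDivergence` (p229606:
`farFlux`, the block divergence identity (A), `nearFlux_eq` (B), the three loop functionals and their bounds) and on leaf-03-g7's K4-b
`NE3CovariantLineSplit` (p229241: `cornerToBond`, the covariant face jump `JmpW`).

WHAT.  In the flat chain (70S) the face jump of an EXACT coarse form is `M²·` a fine gauge mode (`Jmp_dPot`), which a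
flat-divergence-free field kills (`sum_inner_Jmp_dPot_eq_zero`).  At a curved background the corner-framed exact coarse field is
`ω z κ := cD U κ ψ z = Ad_{U(z,κ)} ψ(z+e_κ) − ψ z` (`NE3CovariantCalculus.cD`; the corner reading of C1's `−gaugeDir U ψ`), `U` ANY
unitary `N`-periodic coarse configuration (the consumer's `cavgIter L k W`).  THIS FILE proves, for unitary `(M·N)`-periodic `W`,
`N`-periodic `ψ` and `(M·N)`-periodic `η`:
§1 `cornerToBond` at the face bonds is the κ-last comb of `farFlux` (bridge to file 1);
§2 **`sum_hsR_JmpW_eq`**: `Σ_{x∈periodBox (M·N)} Σ_κ hsR (JmpW M W ω x κ) (η x κ) = M²·Σ_{z∈periodBox N} Σ_κ hsR (ω z κ) (farFlux W M η z κ)`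
   (block tiling + the split chart; ANY `ω`, any units-valued `W`);
§3 coarse covariant summation by parts (`NE3CovariantCalculus.sum_hsR_cD` on the coarse torus):
   `Σ_z Σ_κ hsR (cD U κ ψ z) (F z κ) = −Σ_z hsR (ψ z) (cdiv U F z)`;
§4 the coarse-transport mismatch `coarseMismatch U W M η z := Σ_κ (Ad_{U(z−e_κ,κ)}⁻¹ − Ad_{bseg M W (z−e_κ) κ}⁻¹)(farFlux (z−e_κ) κ)`
   (`= 0` at `U = bseg`-configuration; `‖·‖ ≤ 2·Σ_κ ‖U(z−e_κ,κ) − bseg(…)‖·Σ_t‖η(face bond)‖`) and the assembled divergence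
   **`cdiv_farFlux_eq`**: `cdiv U (farFlux W M η) z = Σ_{v} Ad_{btree}(covDiv W η (M•z+v)) − combDefect z + Σ_κ (farDefect + nearDefect) z κ
   − coarseMismatch z`;
§5 **THE LANDAU KILL `sum_hsR_JmpW_cD_eq`**:
   `Σ_xΣ_κ hsR (JmpW M W (cD U · ψ ·) x κ) (η x κ) = −M²·Σ_{y∈periodBox (M·N)} hsR (covDiv W η y) (psiExt M W ψ y)
      + M²·Σ_{z∈periodBox N} hsR (ψ z) (combDefect W M η z + coarseMismatch U W M η z − Σ_κ (farDefect W M η z κ + nearDefect W M η z κ))`,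
   `psiExt M W ψ y := Ad_{btree M W (cdiv M y) y}⁻¹ (ψ (cdiv M y))` the tree-transported block constant (`NE3CombGaugeCharge` §6's Φ;
   K2's `P = btree`), and its `gaugeDir` form **`sum_hsR_JmpW_cD_eq_gaugeDir`** through `NE3LandauOrbit.sum_hsR_gaugeDir`:
   first term `= −M²·Σ_yΣ_μ hsR (η y μ) (gaugeDir W (psiExt M W ψ) y μ)` — against a covariantly divergence-free `η` it VANISHES, against
   `ρ = covDiv W η′` it is the design's `⟨Φ^W_{ψ′}, ρ⟩` (S4); every remainder is a loop functional of file 1 (first order in `M²a`)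
   or the coarse mismatch.  At `W = U = 1` all remainders vanish: (70S) `sum_inner_Jmp_dPot_eq_zero` + (73S).

HONEST FRAMING.  Exact lattice bookkeeping at a GENERAL unitary background plus quoted isometry bounds, on OUR typed objects; nothing
about Bałaban's minimisers; (P♮)_W, (ML_w) at W ≠ 1, T-E_w and NE3 are NOT proved; spine PROVED 0∕9; finite T⁴ rung (B)+1 — NOT
infinite volume, NOT mass gap, NOT BetaPertH, NOT Clay.  ABSOLUTE RULE kept (nothing printed is a hypothesis; context only:
[Balaban1985Averaging] (42) p. 23, (122)–(125) p. 36; [Balaban1985Variational] (83) p. 290).  PLACEMENT: `Summits/QuantumFields/BalabanUV/`;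
imports accepted modules only (file 1, K4-b, `NE3FrameFreeDecompositionPrep` ⊃ `NE3LandauOrbit`).
-/

set_option autoImplicit false

open scoped BigOperators Matrix.Norms.L2Operator
open Finset

namespace Summit.QuantumFields.BalabanUV.T4Continuum.NE3CovariantLandauKill

open Literature.MathematicalPhysics.QuantumFieldTheory.Balaban1983to89
open B7Prop1Explicit B7Prop2Explicit
open T4AveragingDeficitWall (IsUnitaryCfg SmallField Ad)
open T4AveragingDeficitWallBoundary (periodBox mem_periodBox IsPeriodicCfg)
open T4AveragingDeficitNonAbelian (Ad_mul Ad_sub hol_add_period)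
open AveragingDeficitPeriodicCounting (IsPeriodicDir)
open AveragingDeficitNearIdentity (Ad_one Ad_add Ad_sum Ad_real_smul norm_Ad_sub_le)
open AveragingDeficitTransport (norm_Ad_of_unitary mem_U1_of_unitary)
open AveragingDeficitBlockDensity (btree bseg btree_mem bseg_mem)
open BlockAveragePushDirGauge (gaugeDir)
open NE3CovariantWeitzenbock (covDiv)
open NE3CovariantCalculus (hsR cD cDstar cdiv hsR_sum_left hsR_sum_right hsR_sub_right hsR_add_right hsR_Ad_left hsR_comm
  sum_hsR_cD cdiv_eq_neg_sum_cDstar)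
open NE3LandauOrbit (sum_hsR_gaugeDir hsR_zero_left hsR_neg_right)
open NE3FrameFreeDecompositionPrep (hsR_smul_left)
open NE3BlockPoincareCore (sum_blocks_torus)
open NE3StraightAverageAdjoint (tbase boxVec_funSplitAt_symm cdiv_cmod_block)
open NE3CovariantLineAdjoint (cornerToBond JmpW cornerToBond_mem)
open NE3CovariantBlockDivergence (farFlux nearFlux combDefect farDefect nearDefect sum_periodBox_eq_sum_split
  sum_Ad_btree_covDiv_eq nearFlux_eq farFlux_add_period tbase_nonneg)
open SkeletonLattice (cdiv cmod cdiv_add_period)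

noncomputable section

variable {d : ℕ} {n : Type*} [Fintype n] [DecidableEq n]

/-! ## §1 The face bonds: `cornerToBond` is the κ-last comb of `farFlux` -/

omit [Fintype n] [DecidableEq n] in
/-- The `κ`-coordinate of a transverse offset vanishes. [folklore] -/
theorem tbase_apply_self {M : ℕ} (κ : Fin d) (r' : {j : Fin d // j ≠ κ} → Fin M) : tbase κ r' κ = 0 := by
  simp [tbase]

/-- At the far-face bond `x = M•z + t + (M−1)•e_κ` the K4-b transport is the κ-last comb to the face:
`cornerToBond W M z x κ = (W(Γ_{q,q+t} ++ [q+t, q+t+Me_κ]))⁻¹`. [folklore] -/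
theorem cornerToBond_face (W : Site d → Fin d → (Matrix n n ℂ)ˣ) (M : ℕ) (z : Site d) (κ : Fin d)
    (r' : {j : Fin d // j ≠ κ} → Fin M) :
    cornerToBond W M z ((M : ℤ) • z + tbase κ r' + ((M : ℤ) - 1) • e κ) κ
      = (hol W ((M : ℤ) • z) (treeWord (tbase κ r') ++ seg κ M))⁻¹ := by
  unfold cornerToBond
  have hx : (M : ℤ) • z + tbase κ r' + ((M : ℤ) - 1) • e κ - (M : ℤ) • z = tbase κ r' + ((M : ℤ) - 1) • e κ := by abel
  have hκ : (tbase κ r' + ((M : ℤ) - 1) • e κ) κ = (M : ℤ) - 1 := by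
    simp [tbase_apply_self, e_apply]
  have ht : tbase κ r' + ((M : ℤ) - 1) • e κ - ((M : ℤ) - 1) • e κ = tbase κ r' := by abel
  rw [hx, hκ, ht, sub_add_cancel]

/-! ## §2 The face-jump pairing is `M²·` the coarse pairing with the face fluxes -/

/-- **THE FACE-JUMP PAIRING** (any units-valued `W`, any coarse `ω`, any fine `η`, `M ≥ 1`):
`Σ_{x∈periodBox (M·N)} Σ_κ hsR (JmpW M W ω x κ) (η x κ) = M²·Σ_{z∈periodBox N} Σ_κ hsR (ω z κ) (farFlux W M η z κ)` — block tiling, the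
split chart at `κ`, and `hsR (Ad_P X) Y = hsR X (Ad_{P⁻¹} Y)`. [folklore] -/
theorem sum_hsR_JmpW_eq {M : ℕ} (hM : 1 ≤ M) (N : ℕ) {W : Site d → Fin d → (Matrix n n ℂ)ˣ} (hW : IsUnitaryCfg W)
    (ω η : Site d → Fin d → Matrix n n ℂ) :
    ∑ x ∈ periodBox (d := d) (M * N), ∑ κ : Fin d, hsR (JmpW M W ω x κ) (η x κ)
      = (M : ℝ) ^ 2 * ∑ z ∈ periodBox (d := d) N, ∑ κ : Fin d, hsR (ω z κ) (farFlux W M η z κ) := by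
  rw [← sum_blocks_torus hM N (fun x => ∑ κ : Fin d, hsR (JmpW M W ω x κ) (η x κ)), mul_sum]
  refine sum_congr rfl fun z _ => ?_
  rw [sum_comm, mul_sum]
  refine sum_congr rfl fun κ _ => ?_
  -- one block, one direction: only the far-face bonds carry a jump
  have hterm : ∀ v ∈ periodBox (d := d) M, hsR (JmpW M W ω ((M : ℤ) • z + v) κ) (η ((M : ℤ) • z + v) κ)
      = if v κ = (M : ℤ) - 1 then
          (M : ℝ) ^ 2 * hsR (ω z κ) (Ad (cornerToBond W M z ((M : ℤ) • z + v) κ)⁻¹ (η ((M : ℤ) • z + v) κ)) else 0 := by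
    intro v hv
    obtain ⟨hc, hm⟩ := cdiv_cmod_block (M := M) (z := z) hv
    unfold JmpW
    rw [hm, hc]
    split_ifs with h
    · rw [hsR_smul_left, hsR_Ad_left (cornerToBond_mem hW M z _ κ)]
    · exact hsR_zero_left _
  rw [sum_congr rfl hterm, sum_periodBox_eq_sum_split M κ, farFlux, hsR_sum_right, mul_sum]
  refine Fintype.sum_congr _ _ fun r' => ?_
  have hsel : ∀ a : Fin M, ((tbase κ r' + ((a : ℕ) : ℤ) • e κ) κ = (M : ℤ) - 1) ↔ a = ⟨M - 1, by omega⟩ := by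
    intro a
    rw [Fin.ext_iff]
    simp only [Pi.add_apply, tbase_apply_self, Pi.smul_apply, e_apply, if_true, smul_eq_mul, mul_one, zero_add]
    have := a.isLt
    omega
  simp_rw [hsel]
  simp only [Finset.sum_ite_eq', Finset.mem_univ, if_true, Nat.cast_pred hM, ← add_assoc]
  rw [cornerToBond_face, inv_inv]

/-! ## §3 Coarse covariant summation by parts -/

/-- **COARSE SUMMATION BY PARTS FOR A CORNER-FRAMED EXACT FIELD**: for unitary `N`-periodic `U`, `N`-periodic `ψ` and `F` (`N ≥ 1`),
`Σ_{z∈periodBox N} Σ_κ hsR (cD U κ ψ z) (F z κ) = −Σ_z hsR (ψ z) (cdiv U F z)` (`sum_hsR_cD` per direction; `cdiv = −Σ_κ cDstar_κ`).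
[folklore] -/
theorem sum_hsR_cD_eq_neg_sum_hsR_cdiv {N : ℕ} (hN : 1 ≤ N) {U : Site d → Fin d → (Matrix n n ℂ)ˣ} (hU : IsUnitaryCfg U)
    (hUP : IsPeriodicCfg U (N : ℤ)) {ψ : Site d → Matrix n n ℂ} (hψ : ∀ (z : Site d) (τ : Fin d), ψ (z + (N : ℤ) • e τ) = ψ z)
    {F : Site d → Fin d → Matrix n n ℂ} (hF : ∀ (z : Site d) (τ κ : Fin d), F (z + (N : ℤ) • e τ) κ = F z κ) :
    ∑ z ∈ periodBox (d := d) N, ∑ κ : Fin d, hsR (cD U κ ψ z) (F z κ)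
      = -∑ z ∈ periodBox (d := d) N, hsR (ψ z) (cdiv U F z) := by
  rw [sum_comm]
  have hκ : ∀ κ : Fin d, ∑ z ∈ periodBox (d := d) N, hsR (cD U κ ψ z) (F z κ)
      = ∑ z ∈ periodBox (d := d) N, hsR (ψ z) (cDstar U κ (fun y => F y κ) z) :=
    fun κ => sum_hsR_cD hN hU hUP κ hψ (fun z τ => hF z τ κ)
  rw [sum_congr rfl fun κ _ => hκ κ, sum_comm, ← sum_neg_distrib]
  refine sum_congr rfl fun z _ => ?_
  rw [cdiv_eq_neg_sum_cDstar, hsR_neg_right, neg_neg, hsR_sum_right]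

/-! ## §4 The coarse-transport mismatch and the assembled coarse divergence of the face fluxes -/

/-- THE COARSE-TRANSPORT MISMATCH: the near-face flux of `B(z)` transported by the consumer's coarse bond variable `U(z−e_κ, κ)`
versus by the straight segment `bseg M W (z−e_κ) κ = W([q − Me_κ, q])` (zero when `U` IS the straight-segment configuration).
[folklore] -/
def coarseMismatch (U W : Site d → Fin d → (Matrix n n ℂ)ˣ) (M : ℕ) (η : Site d → Fin d → Matrix n n ℂ) (z : Site d) :
    Matrix n n ℂ :=
  ∑ κ : Fin d, (Ad (U (z - e κ) κ)⁻¹ (farFlux W M η (z - e κ) κ) - Ad (bseg M W (z - e κ) κ)⁻¹ (farFlux W M η (z - e κ) κ))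

/-- At the straight-segment coarse configuration the mismatch vanishes. [folklore] -/
theorem coarseMismatch_bseg (W : Site d → Fin d → (Matrix n n ℂ)ˣ) (M : ℕ) (η : Site d → Fin d → Matrix n n ℂ) (z : Site d) :
    coarseMismatch (fun y μ => bseg M W y μ) W M η z = 0 := by
  unfold coarseMismatch
  simp

/-- **THE COARSE DIVERGENCE OF THE FACE FLUXES IS THE BLOCK SUM OF THE TRANSPORTED FINE DIVERGENCE, UP TO LOOPS** (file 1 (A)+(B);
EXACT at every units-valued `W`, `U`):
`cdiv U (farFlux W M η) z = Σ_{v∈periodBox M} Ad_{btree(M•z+v)} (covDiv W η (M•z+v)) − combDefect z + Σ_κ (farDefect + nearDefect) z κ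
 − coarseMismatch U W M η z`. [folklore] -/
theorem cdiv_farFlux_eq (U W : Site d → Fin d → (Matrix n n ℂ)ˣ) (M : ℕ) (η : Site d → Fin d → Matrix n n ℂ) (z : Site d) :
    cdiv U (farFlux W M η) z
      = ∑ v ∈ periodBox (d := d) M, Ad (btree M W z ((M : ℤ) • z + v)) (covDiv W η ((M : ℤ) • z + v))
        - combDefect W M η z + ∑ κ : Fin d, (farDefect W M η z κ + nearDefect W M η z κ) - coarseMismatch U W M η z := by
  rw [sum_Ad_btree_covDiv_eq, NE3CovariantCalculus.cdiv, coarseMismatch, add_sub_cancel_right, ← sum_add_distrib,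
    ← sum_sub_distrib]
  refine sum_congr rfl fun κ _ => ?_
  rw [nearFlux_eq]
  abel

/-- `‖Ad_a X − Ad_b X‖ ≤ 2·‖a − b‖·‖X‖` for unitary units. [folklore] -/
theorem norm_Ad_sub_Ad_le' [Nonempty n] {a b : (Matrix n n ℂ)ˣ} (ha : a ∈ unitaryUnits (Matrix n n ℂ))
    (hb : b ∈ unitaryUnits (Matrix n n ℂ)) (X : Matrix n n ℂ) :
    ‖Ad a X - Ad b X‖ ≤ 2 * ‖(a : Matrix n n ℂ) - (b : Matrix n n ℂ)‖ * ‖X‖ := by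
  have hba : b⁻¹ * a ∈ unitaryUnits (Matrix n n ℂ) := Subgroup.mul_mem _ (Subgroup.inv_mem _ hb) ha
  have h1 : Ad a X - Ad b X = Ad b (Ad (b⁻¹ * a) X - X) := by
    rw [Ad_sub, ← Ad_mul, mul_inv_cancel_left]
  rw [h1, norm_Ad_of_unitary hb]
  refine (norm_Ad_sub_le hba X).trans ?_
  have h2 : ((b⁻¹ * a : (Matrix n n ℂ)ˣ) : Matrix n n ℂ) - 1 = ((b⁻¹ : (Matrix n n ℂ)ˣ) : Matrix n n ℂ) * ((a : Matrix n n ℂ) - b) := by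
    rw [Units.val_mul, mul_sub, Units.inv_mul]
  have h3 : ‖((b⁻¹ * a : (Matrix n n ℂ)ˣ) : Matrix n n ℂ) - 1‖ ≤ ‖(a : Matrix n n ℂ) - (b : Matrix n n ℂ)‖ := by
    rw [h2]
    refine (norm_mul_le _ _).trans ?_
    have hb1 : ‖((b⁻¹ : (Matrix n n ℂ)ˣ) : Matrix n n ℂ)‖ ≤ 1 := (mem_U1_of_unitary ((unitaryUnits _).inv_mem hb)).1
    calc _ ≤ 1 * ‖(a : Matrix n n ℂ) - (b : Matrix n n ℂ)‖ := by gcongr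
      _ = _ := one_mul _
  gcongr

/-- The face flux is a sum of isometric images: `‖farFlux W M η z κ‖ ≤ Σ_t ‖η (M•z + t + (M−1)e_κ) κ‖` (unitary `W`). [folklore] -/
theorem norm_farFlux_le [Nonempty n] {W : Site d → Fin d → (Matrix n n ℂ)ˣ} (hW : IsUnitaryCfg W) (M : ℕ)
    (η : Site d → Fin d → Matrix n n ℂ) (z : Site d) (κ : Fin d) :
    ‖farFlux W M η z κ‖ ≤ ∑ r' : {j : Fin d // j ≠ κ} → Fin M, ‖η ((M : ℤ) • z + tbase κ r' + ((M : ℤ) - 1) • e κ) κ‖ := by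
  unfold farFlux
  refine (norm_sum_le _ _).trans (sum_le_sum fun r' _ => le_of_eq ?_)
  exact norm_Ad_of_unitary (hol_mem_of hW _ _) _

/-- `‖a⁻¹ − b⁻¹‖ ≤ ‖a − b‖` for unitary units (`a⁻¹ − b⁻¹ = a⁻¹(b − a)b⁻¹`). [folklore] -/
theorem norm_inv_sub_inv_le [Nonempty n] {a b : (Matrix n n ℂ)ˣ} (ha : a ∈ unitaryUnits (Matrix n n ℂ)) (hb : b ∈ unitaryUnits (Matrix n n ℂ)) :
    ‖((a⁻¹ : (Matrix n n ℂ)ˣ) : Matrix n n ℂ) - ((b⁻¹ : (Matrix n n ℂ)ˣ) : Matrix n n ℂ)‖ ≤ ‖(a : Matrix n n ℂ) - (b : Matrix n n ℂ)‖ := by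
  have hid : ((a⁻¹ : (Matrix n n ℂ)ˣ) : Matrix n n ℂ) - ((b⁻¹ : (Matrix n n ℂ)ˣ) : Matrix n n ℂ)
      = ((a⁻¹ : (Matrix n n ℂ)ˣ) : Matrix n n ℂ) * ((b : Matrix n n ℂ) - (a : Matrix n n ℂ)) * ((b⁻¹ : (Matrix n n ℂ)ˣ) : Matrix n n ℂ) := by
    rw [mul_sub, sub_mul, Units.mul_inv_cancel_right, Units.inv_mul, one_mul]
  rw [hid]
  have h1 : ‖((a⁻¹ : (Matrix n n ℂ)ˣ) : Matrix n n ℂ)‖ ≤ 1 := (mem_U1_of_unitary ((unitaryUnits _).inv_mem ha)).1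
  have h2 : ‖((b⁻¹ : (Matrix n n ℂ)ˣ) : Matrix n n ℂ)‖ ≤ 1 := (mem_U1_of_unitary ((unitaryUnits _).inv_mem hb)).1
  calc _ ≤ ‖((a⁻¹ : (Matrix n n ℂ)ˣ) : Matrix n n ℂ)‖ * ‖(b : Matrix n n ℂ) - (a : Matrix n n ℂ)‖
          * ‖((b⁻¹ : (Matrix n n ℂ)ˣ) : Matrix n n ℂ)‖ := norm_mul₃_le
    _ ≤ 1 * ‖(b : Matrix n n ℂ) - (a : Matrix n n ℂ)‖ * 1 := by gcongr
    _ = _ := by rw [one_mul, mul_one, norm_sub_rev]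

/-- **SIZE OF THE COARSE MISMATCH**: `‖coarseMismatch U W M η z‖ ≤ Σ_κ 2‖U(z−e_κ,κ) − bseg M W (z−e_κ) κ‖ · Σ_t ‖η(face bond of B(z−e_κ))‖`
(unitary `U`, `W`). [folklore] -/
theorem norm_coarseMismatch_le [Nonempty n] {U W : Site d → Fin d → (Matrix n n ℂ)ˣ} (hU : IsUnitaryCfg U) (hW : IsUnitaryCfg W)
    (M : ℕ) (η : Site d → Fin d → Matrix n n ℂ) (z : Site d) :
    ‖coarseMismatch U W M η z‖
      ≤ ∑ κ : Fin d, 2 * ‖((U (z - e κ) κ : (Matrix n n ℂ)ˣ) : Matrix n n ℂ) - bseg M W (z - e κ) κ‖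
          * ∑ r' : {j : Fin d // j ≠ κ} → Fin M, ‖η ((M : ℤ) • (z - e κ) + tbase κ r' + ((M : ℤ) - 1) • e κ) κ‖ := by
  unfold coarseMismatch
  refine (norm_sum_le _ _).trans (sum_le_sum fun κ _ => ?_)
  have hUu : U (z - e κ) κ ∈ unitaryUnits (Matrix n n ℂ) := hU _ κ
  have hSu : bseg M W (z - e κ) κ ∈ unitaryUnits (Matrix n n ℂ) := bseg_mem hW M _ κ
  have hUi : (U (z - e κ) κ)⁻¹ ∈ unitaryUnits (Matrix n n ℂ) := (unitaryUnits _).inv_mem hUu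
  have hSi : (bseg M W (z - e κ) κ)⁻¹ ∈ unitaryUnits (Matrix n n ℂ) := (unitaryUnits _).inv_mem hSu
  have hA := norm_Ad_sub_Ad_le' hUi hSi (farFlux W M η (z - e κ) κ)
  have hinv := norm_inv_sub_inv_le hUu hSu
  have hF := norm_farFlux_le hW M η (z - e κ) κ
  have h2 : 0 ≤ 2 * ‖((U (z - e κ) κ : (Matrix n n ℂ)ˣ) : Matrix n n ℂ) - bseg M W (z - e κ) κ‖ := by positivity
  calc _ ≤ 2 * ‖(((U (z - e κ) κ)⁻¹ : (Matrix n n ℂ)ˣ) : Matrix n n ℂ) - (((bseg M W (z - e κ) κ)⁻¹ : (Matrix n n ℂ)ˣ) : Matrix n n ℂ)‖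
          * ‖farFlux W M η (z - e κ) κ‖ := hA
    _ ≤ 2 * ‖((U (z - e κ) κ : (Matrix n n ℂ)ˣ) : Matrix n n ℂ) - bseg M W (z - e κ) κ‖ * ‖farFlux W M η (z - e κ) κ‖ :=
        mul_le_mul_of_nonneg_right (mul_le_mul_of_nonneg_left hinv (by norm_num)) (norm_nonneg _)
    _ ≤ _ := mul_le_mul_of_nonneg_left hF h2

/-! ## §5 The Landau kill -/

/-- THE TREE-TRANSPORTED BLOCK CONSTANT (`NE3CombGaugeCharge` §6's Φ with the corner charge of the block of `y`; K2's `P = btree`):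
`psiExt M W ψ y := Ad_{btree M W (cdiv M y) y}⁻¹ (ψ (cdiv M y))`. [folklore] -/
def psiExt (M : ℕ) (W : Site d → Fin d → (Matrix n n ℂ)ˣ) (ψ : Site d → Matrix n n ℂ) (y : Site d) : Matrix n n ℂ :=
  Ad (btree M W (cdiv M y) y)⁻¹ (ψ (cdiv M y))

/-- `psiExt` of `N`-periodic data at an `(M·N)`-periodic background is `(M·N)`-periodic. [folklore] -/
theorem psiExt_add_period {M N : ℕ} (hM : 1 ≤ M) {W : Site d → Fin d → (Matrix n n ℂ)ˣ} (hWP : IsPeriodicCfg W ((M * N : ℕ) : ℤ))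
    {ψ : Site d → Matrix n n ℂ} (hψ : ∀ (z : Site d) (τ : Fin d), ψ (z + (N : ℤ) • e τ) = ψ z) (y : Site d) (τ : Fin d) :
    psiExt M W ψ (y + ((M * N : ℕ) : ℤ) • e τ) = psiExt M W ψ y := by
  unfold psiExt
  have hc := cdiv_add_period (L := M) hM (N : ℤ) y τ
  have hMN : ((M : ℤ) * (N : ℤ)) = ((M * N : ℕ) : ℤ) := by push_cast; ring
  rw [← hMN, hc, hψ]
  congr 2
  rw [btree, btree, smul_add, smul_smul, hMN, show y + ((M * N : ℕ) : ℤ) • e τ - ((M : ℤ) • cdiv M y + ((M * N : ℕ) : ℤ) • e τ)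
    = y - (M : ℤ) • cdiv M y by abel, hol_add_period hWP τ]

/-- The block sum pairing re-read on the fine torus: `Σ_z hsR (ψ z) (Σ_v Ad_{btree} covDiv(M•z+v)) = Σ_y hsR (covDiv W η y) (psiExt y)`.
[folklore] -/
theorem sum_hsR_blockSum_eq {M : ℕ} (hM : 1 ≤ M) (N : ℕ) {W : Site d → Fin d → (Matrix n n ℂ)ˣ} (hW : IsUnitaryCfg W)
    (ψ : Site d → Matrix n n ℂ) (η : Site d → Fin d → Matrix n n ℂ) :
    ∑ z ∈ periodBox (d := d) N, hsR (ψ z) (∑ v ∈ periodBox (d := d) M, Ad (btree M W z ((M : ℤ) • z + v)) (covDiv W η ((M : ℤ) • z + v)))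
      = ∑ y ∈ periodBox (d := d) (M * N), hsR (covDiv W η y) (psiExt M W ψ y) := by
  rw [← sum_blocks_torus hM N (fun y => hsR (covDiv W η y) (psiExt M W ψ y))]
  refine sum_congr rfl fun z _ => ?_
  rw [hsR_sum_right]
  refine sum_congr rfl fun v hv => ?_
  obtain ⟨hc, _⟩ := cdiv_cmod_block (M := M) (z := z) hv
  rw [psiExt, hc, hsR_comm, hsR_Ad_left (btree_mem hW M z _)]

/-- **THE LANDAU KILL AT A CURVED BACKGROUND** (`M, N ≥ 1`; unitary `(M·N)`-periodic `W`; unitary `N`-periodic coarse `U`; `N`-periodic `ψ`;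
`(M·N)`-periodic `η`): the face-jump pairing of the corner-framed exact coarse field `D_U ψ` against `η` is `−M²·` the pairing of the
fine covariant divergence of `η` with the tree-transported block constant, plus `M²·` explicit loop functionals:
`Σ_xΣ_κ hsR (JmpW M W (D_Uψ) x κ) (η x κ) = −M²·Σ_y hsR (covDiv W η y) (psiExt y) + M²·Σ_z hsR (ψ z) (combDefect z + coarseMismatch z − Σ_κ (farDefect + nearDefect) z κ)`.
[folklore] -/
theorem sum_hsR_JmpW_cD_eq {M N : ℕ} (hM : 1 ≤ M) (hN : 1 ≤ N) {W : Site d → Fin d → (Matrix n n ℂ)ˣ} (hW : IsUnitaryCfg W)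
    (hWP : IsPeriodicCfg W ((M * N : ℕ) : ℤ)) {U : Site d → Fin d → (Matrix n n ℂ)ˣ} (hU : IsUnitaryCfg U)
    (hUP : IsPeriodicCfg U (N : ℤ)) {ψ : Site d → Matrix n n ℂ} (hψ : ∀ (z : Site d) (τ : Fin d), ψ (z + (N : ℤ) • e τ) = ψ z)
    {η : Site d → Fin d → Matrix n n ℂ} (hη : ∀ (x : Site d) (τ μ : Fin d), η (x + ((M * N : ℕ) : ℤ) • e τ) μ = η x μ) :
    ∑ x ∈ periodBox (d := d) (M * N), ∑ κ : Fin d, hsR (JmpW M W (fun z κ => cD U κ ψ z) x κ) (η x κ)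
      = -((M : ℝ) ^ 2 * ∑ y ∈ periodBox (d := d) (M * N), hsR (covDiv W η y) (psiExt M W ψ y))
        + (M : ℝ) ^ 2 * ∑ z ∈ periodBox (d := d) N, hsR (ψ z)
            (combDefect W M η z + coarseMismatch U W M η z - ∑ κ : Fin d, (farDefect W M η z κ + nearDefect W M η z κ)) := by
  rw [sum_hsR_JmpW_eq hM N hW, sum_hsR_cD_eq_neg_sum_hsR_cdiv hN hU hUP hψ (fun z τ κ => farFlux_add_period hWP hη z τ κ),
    ← sum_hsR_blockSum_eq hM N hW ψ η]
  have key : ∀ z : Site d, hsR (ψ z) (NE3CovariantCalculus.cdiv U (farFlux W M η) z)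
      = hsR (ψ z) (∑ v ∈ periodBox (d := d) M, Ad (btree M W z ((M : ℤ) • z + v)) (covDiv W η ((M : ℤ) • z + v)))
        - hsR (ψ z) (combDefect W M η z + coarseMismatch U W M η z
            - ∑ κ : Fin d, (farDefect W M η z κ + nearDefect W M η z κ)) := by
    intro z
    rw [cdiv_farFlux_eq, ← hsR_sub_right]
    congr 1
    abel
  rw [sum_congr rfl fun z _ => key z, sum_sub_distrib]
  ring

/-- **THE LANDAU KILL, `gaugeDir` FORM** (`NE3LandauOrbit.sum_hsR_gaugeDir`): the main term is
`−M²·Σ_yΣ_μ hsR (η y μ) (gaugeDir W (psiExt M W ψ) y μ)` — it VANISHES for `η` orthogonal to the linearised gauge directions of the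
tree-transported block constants (in particular for a covariantly divergence-free `η`). [folklore] -/
theorem sum_hsR_JmpW_cD_eq_gaugeDir {M N : ℕ} (hM : 1 ≤ M) (hN : 1 ≤ N) {W : Site d → Fin d → (Matrix n n ℂ)ˣ} (hW : IsUnitaryCfg W)
    (hWP : IsPeriodicCfg W ((M * N : ℕ) : ℤ)) {U : Site d → Fin d → (Matrix n n ℂ)ˣ} (hU : IsUnitaryCfg U)
    (hUP : IsPeriodicCfg U (N : ℤ)) {ψ : Site d → Matrix n n ℂ} (hψ : ∀ (z : Site d) (τ : Fin d), ψ (z + (N : ℤ) • e τ) = ψ z)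
    {η : Site d → Fin d → Matrix n n ℂ} (hη : IsPeriodicDir η ((M * N : ℕ) : ℤ)) :
    ∑ x ∈ periodBox (d := d) (M * N), ∑ κ : Fin d, hsR (JmpW M W (fun z κ => cD U κ ψ z) x κ) (η x κ)
      = -((M : ℝ) ^ 2 * ∑ y ∈ periodBox (d := d) (M * N), ∑ μ : Fin d, hsR (η y μ) (gaugeDir W (psiExt M W ψ) y μ))
        + (M : ℝ) ^ 2 * ∑ z ∈ periodBox (d := d) N, hsR (ψ z)
            (combDefect W M η z + coarseMismatch U W M η z - ∑ κ : Fin d, (farDefect W M η z κ + nearDefect W M η z κ)) := by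
  have hMN : 1 ≤ M * N := Nat.one_le_iff_ne_zero.mpr (Nat.mul_ne_zero (by omega) (by omega))
  rw [sum_hsR_gaugeDir hMN hW hη (fun y τ => psiExt_add_period hM hWP hψ y τ)]
  exact sum_hsR_JmpW_cD_eq hM hN hW hWP hU hUP hψ (fun x τ μ => hη x τ μ)

/-- **COVARIANTLY DIVERGENCE-FREE `η`: ONLY THE LOOP FUNCTIONALS SURVIVE.** [folklore] -/
theorem sum_hsR_JmpW_cD_eq_of_covDiv_eq_zero {M N : ℕ} (hM : 1 ≤ M) (hN : 1 ≤ N) {W : Site d → Fin d → (Matrix n n ℂ)ˣ}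
    (hW : IsUnitaryCfg W) (hWP : IsPeriodicCfg W ((M * N : ℕ) : ℤ)) {U : Site d → Fin d → (Matrix n n ℂ)ˣ} (hU : IsUnitaryCfg U)
    (hUP : IsPeriodicCfg U (N : ℤ)) {ψ : Site d → Matrix n n ℂ} (hψ : ∀ (z : Site d) (τ : Fin d), ψ (z + (N : ℤ) • e τ) = ψ z)
    {η : Site d → Fin d → Matrix n n ℂ} (hη : ∀ (x : Site d) (τ μ : Fin d), η (x + ((M * N : ℕ) : ℤ) • e τ) μ = η x μ)
    (hdiv : ∀ y ∈ periodBox (d := d) (M * N), covDiv W η y = 0) :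
    ∑ x ∈ periodBox (d := d) (M * N), ∑ κ : Fin d, hsR (JmpW M W (fun z κ => cD U κ ψ z) x κ) (η x κ)
      = (M : ℝ) ^ 2 * ∑ z ∈ periodBox (d := d) N, hsR (ψ z)
            (combDefect W M η z + coarseMismatch U W M η z - ∑ κ : Fin d, (farDefect W M η z κ + nearDefect W M η z κ)) := by
  rw [sum_hsR_JmpW_cD_eq hM hN hW hWP hU hUP hψ hη, sum_eq_zero fun y hy => by rw [hdiv y hy, hsR_zero_left]]
  simp

end

end Summit.QuantumFields.BalabanUV.T4Continuum.NE3CovariantLandauKill
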